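import Literature.MathematicalPhysics.QuantumLattice.PeierlsChessboardTorusBound
import HarnessLib

/-!
# From the Peierls–chessboard two-point bound to a long-range-order floor for a two-valued
# observable (Fröhlich–Lieb 1978, §I.B (1.11)–(1.24), case `P^{<δ} = 0`)

Topic `MathematicalPhysics/QuantumLattice`; a corollary of
`PeierlsChessboardTorusBound.peierls_chessboard_twoPoint_le`. Fröhlich–Lieb §I.B reduce long-range
order `⟨m₀ mⱼ⟩ ≥ M² > 0` "uniformly in `Λ` and `j`" to the smallness of `⟨P₀⁺Pⱼ⁻⟩` (their term
II, (1.13)–(1.15)) plus a thermodynamic estimate of `⟨P₀^{<δ}⟩` (term III, (1.16)–(1.18)). For a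
TWO-VALUED single-site observable `σ = P⁺ - P⁻` (`P⁺ + P⁻ = 1`; e.g. the sign of `S^z` for
half-integer spin, where `P^{<δ} = 0` for `δ ≤ 1/(2S)`) the reduction is an identity:
`σₘσₙ = 1 - 2PₘPₙ⁻ - 2Pₘ⁻Pₙ⁺` (`onSite_sigma_mul_onSite_sigma`), so

* **`peierls_chessboard_sigma_twoPoint_ge`** — under the hypotheses of
  `peierls_chessboard_twoPoint_le` (RP + translation invariance + dipole smallness `κ`,
  `ρ = 4·19⁶·κ^{(b-1)/b⁵} < 1`): `Re⟨σₘσₙ⟩_{β,H} ≥ 1 - 4·(4ρ/(1-ρ)²) = 1 - 16ρ/(1-ρ)²` for all `m ≠ n`,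
  uniformly in the volume — a long-range-order FLOOR from the single certified datum `κ`;
* `peierls_chessboard_sigma_twoPoint_ge_half` — the quotable threshold: `κ^{(b-1)/b⁵} ≤ 10⁻¹⁰`
  gives `Re⟨σₘσₙ⟩ ≥ 1/2` for all `m ≠ n`, every volume;
* `heisAnisoReal_sigma_twoPoint_ge` — the same for the rotated antiferromagnet with
  direction-dependent couplings `K ≥ 0`.

No named facts; no sorries.

## References

* J. Fröhlich, E. H. Lieb, Comm. Math. Phys. **60** (1978) 233–267, §I.B eqs. (1.8)–(1.24),
  Thm. 1.1, Cor. 1.2. [FrohlichLieb1978]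
-/

noncomputable section

open Matrix Finset NormedSpace
open scoped Kronecker ComplexOrder MatrixOrder BigOperators
open Literature.MathematicalPhysics.QuantumLattice Literature.Probability.LatticeModels
  Literature.Barriers.CriticalPhenomena.NonGibbs

namespace Literature.MathematicalPhysics.QuantumLattice

section Sigma

variable {Λ : Type*} [Fintype Λ] [DecidableEq Λ] {q : ℕ}

/-- **FL (1.11) for a two-valued observable**: with `σ = P⁺ - P⁻` and `P⁺ + P⁻ = 1`,
`σₘσₙ = 1 - 2PₘPₙ⁻ - 2Pₘ⁻Pₙ⁺` (terms I, II of (1.11); term III vanishes).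
[cite: FrohlichLieb1978, eqs. (1.11)–(1.12), (1.19)] -/
theorem onSite_sigma_mul_onSite_sigma {Pp Pm : Matrix (Fin q) (Fin q) ℂ} (hsum : Pp + Pm = 1)
    (m n : Λ) :
    (onSite m (Pp - Pm) * onSite n (Pp - Pm) : Op Λ q) =
      1 - 2 • (onSite m Pp * onSite n Pm) - 2 • (onSite m Pm * onSite n Pp) := by
  have hPm : Pm = 1 - Pp := by rw [← hsum, add_sub_cancel_left]
  rw [hPm, onSite_sub', onSite_sub', onSite_sub', onSite_sub', onSite_one', onSite_one']
  noncomm_ring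

/-- The two-point function of `σ` in any linear functional with `ω(1) = 1`.
[cite: FrohlichLieb1978, eqs. (1.11), (1.19)–(1.23)] -/
theorem re_sigma_twoPoint_eq {Pp Pm : Matrix (Fin q) (Fin q) ℂ} (hsum : Pp + Pm = 1) {m n : Λ}
    (hmn : m ≠ n) (ω : Op Λ q →ₗ[ℂ] ℂ) (hω : ω 1 = 1) :
    (ω (onSite m (Pp - Pm) * onSite n (Pp - Pm))).re =
      1 - 2 * (ω (onSite m Pp * onSite n Pm)).re - 2 * (ω (onSite n Pp * onSite m Pm)).re := by
  rw [onSite_sigma_mul_onSite_sigma hsum, onSite_mul_onSite_comm hmn Pm Pp, map_sub, map_sub,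
    map_nsmul, map_nsmul, hω]
  simp only [Complex.sub_re, Complex.one_re, nsmul_eq_mul, Nat.cast_ofNat, Complex.mul_re,
    Complex.re_ofNat, Complex.im_ofNat, zero_mul, sub_zero]

end Sigma

/-! ### The long-range-order floor on the torus -/

section Main

variable {N b : ℕ} [NeZero N] [NeZero b] {n : ℕ}

/-- **Long-range-order floor for a two-valued observable from the Peierls–chessboard bound
(FL §I.B + Thm. 1.1 + Cor. 1.2 + (1.44)), uniformly in the volume.** Let `H` be Hermitian and
translation invariant on `(ℤ/Nbℤ)²` (`N` even, `N > 1`, `Nb ≥ 3`) with `-βH` reflection positive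
across the lines between the squares of side `b`; real single-site `0 ≤ P±` with `P⁺ + P⁻ = 1`,
`σ := P⁺ - P⁻`; `0 < κ ≤ 1` a dipole smallness bound `Re⟨P_Λ(p)⟩ ≤ κ^{N²}`; and
`ρ := 4·19⁶·κ^{(b-1)/b⁵} < 1`. Then for all `m ≠ n`:
`Re⟨σₘσₙ⟩_{β,H} ≥ 1 - 16ρ/(1-ρ)²`. [cite: FrohlichLieb1978, eqs. (1.9), (1.11)–(1.24), Thm. 1.1, Cor. 1.2] -/
theorem peierls_chessboard_sigma_twoPoint_ge [NeZero (N * b)] (hN : Even N) (hN1 : 1 < N)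
    (hL : 2 < N * b) {β : ℝ} {H : Op (TorusSite 2 (N * b)) (n + 1)} (hH : H.IsHermitian)
    (hK : ∀ (i : Fin 2) (k : ZMod N),
      IsRPExponent (N * b) i (blockPlane N b k) (hN.mul_right b) (-(β : ℂ) • H))
    (hT : ∀ v : TorusSite 2 (N * b),
      H.submatrix (fun σ => σ ∘ ⇑(Equiv.addRight v)) (fun σ => σ ∘ ⇑(Equiv.addRight v)) = H)
    {Pp Pm : Matrix (Fin (n + 1)) (Fin (n + 1)) ℂ} (hPp : Pp.PosSemidef) (hPm : Pm.PosSemidef)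
    (hsum : Pp + Pm = 1) (hPpr : Pp.map (starRingEnd ℂ) = Pp) (hPmr : Pm.map (starRingEnd ℂ) = Pm)
    {κ : ℝ} (hκ0 : 0 < κ) (hκ1 : κ ≤ 1)
    (hsmall : ∀ (v i j : TorusSite 2 (N * b)),
      (∃ k : Fin 2, j = i + Pi.single k 1 ∨ i = j + Pi.single k 1) →
      blockOf N b (i - v) = blockOf N b (j - v) →
      (Matrix.gibbsState β H (productOp fun y =>
        cubePattern hN v (selectedOp Pp Pm {i} {j}) (blockOf N b (i - v))
          (mirroredOffset hN y))).re ≤ κ ^ (N ^ 2))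
    (hρ : 4 * 19 ^ 6 * κ ^ (((b - 1 : ℕ) : ℝ) / (b : ℝ) ^ (2 * 2 + 1)) < 1)
    {m n' : TorusSite 2 (N * b)} (hmn : m ≠ n') :
    1 - 4 * (4 * (4 * 19 ^ 6 * κ ^ (((b - 1 : ℕ) : ℝ) / (b : ℝ) ^ (2 * 2 + 1))) /
        (1 - 4 * 19 ^ 6 * κ ^ (((b - 1 : ℕ) : ℝ) / (b : ℝ) ^ (2 * 2 + 1))) ^ 2) ≤
      (Matrix.gibbsState β H (onSite m (Pp - Pm) * onSite n' (Pp - Pm))).re := by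
  haveI : Nonempty (TensorIndex (TorusSite 2 (N * b)) (n + 1)) := ⟨fun _ => 0⟩
  have hone : Matrix.gibbsState β H 1 = 1 := gibbsState_one β H (partitionFn_pos β hH).ne'
  rw [re_sigma_twoPoint_eq hsum hmn (Matrix.gibbsState β H) hone]
  have h1 := peierls_chessboard_twoPoint_le hN hN1 hL hH hK hT hPp hPm hsum hPpr hPmr hκ0 hκ1 hsmall hρ hmn
  have h2 := peierls_chessboard_twoPoint_le hN hN1 hL hH hK hT hPp hPm hsum hPpr hPmr hκ0 hκ1 hsmall hρ
    hmn.symm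
  linarith

end Main

/-! ### A quotable threshold -/

section Threshold

variable {N b : ℕ} [NeZero N] [NeZero b] {n : ℕ}

/-- Arithmetic of the threshold: `θ ≤ 10⁻¹⁰` gives `ρ = 4·19⁶θ < 1` and `16ρ/(1-ρ)² ≤ 1/2`.
[folklore] -/
private theorem pctl_threshold {θ : ℝ} (hθ0 : 0 ≤ θ) (hθ : θ ≤ 1 / 10 ^ 10) :
    4 * 19 ^ 6 * θ < 1 ∧ (1 : ℝ) / 2 ≤ 1 - 4 * (4 * (4 * 19 ^ 6 * θ) / (1 - 4 * 19 ^ 6 * θ) ^ 2) := by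
  have hρ : 4 * 19 ^ 6 * θ ≤ 1 / 50 := by
    calc (4 * 19 ^ 6 * θ : ℝ) ≤ 4 * 19 ^ 6 * (1 / 10 ^ 10) := by gcongr
      _ ≤ 1 / 50 := by norm_num
  have hρ0 : 0 ≤ 4 * 19 ^ 6 * θ := by positivity
  refine ⟨by linarith, ?_⟩
  have hden : (49 / 50 : ℝ) ^ 2 ≤ (1 - 4 * 19 ^ 6 * θ) ^ 2 := by
    have h1 : (49 / 50 : ℝ) ≤ 1 - 4 * 19 ^ 6 * θ := by linarith
    exact pow_le_pow_left₀ (by norm_num) h1 2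
  have hfrac : 4 * (4 * 19 ^ 6 * θ) / (1 - 4 * 19 ^ 6 * θ) ^ 2 ≤ 4 * (1 / 50) / (49 / 50) ^ 2 := by
    rw [div_le_div_iff₀ (lt_of_lt_of_le (by norm_num) hden) (by norm_num)]
    calc 4 * (4 * 19 ^ 6 * θ) * (49 / 50 : ℝ) ^ 2 ≤ 4 * (1 / 50) * (49 / 50) ^ 2 := by gcongr
      _ ≤ 4 * (1 / 50) * (1 - 4 * 19 ^ 6 * θ) ^ 2 := by gcongr
  have : 4 * (1 / 50) / (49 / 50 : ℝ) ^ 2 ≤ 1 / 8 := by norm_num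
  linarith

/-- **A quotable threshold.** Under the hypotheses of `peierls_chessboard_sigma_twoPoint_ge`, if the
dipole smallness datum satisfies `κ^{(b-1)/b⁵} ≤ 10⁻¹⁰` then `Re⟨σₘσₙ⟩_{β,H} ≥ 1/2` for all
`m ≠ n` on every torus `(ℤ/Nbℤ)²` (`N` even, `N > 1`, `Nb ≥ 3`): long-range order of `σ` with
floor `1/2`, uniformly in the volume. [cite: FrohlichLieb1978, Thm. 1.1, Cor. 1.2, eqs. (1.23)–(1.24)] -/
theorem peierls_chessboard_sigma_twoPoint_ge_half [NeZero (N * b)] (hN : Even N) (hN1 : 1 < N)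
    (hL : 2 < N * b) {β : ℝ} {H : Op (TorusSite 2 (N * b)) (n + 1)} (hH : H.IsHermitian)
    (hK : ∀ (i : Fin 2) (k : ZMod N),
      IsRPExponent (N * b) i (blockPlane N b k) (hN.mul_right b) (-(β : ℂ) • H))
    (hT : ∀ v : TorusSite 2 (N * b),
      H.submatrix (fun σ => σ ∘ ⇑(Equiv.addRight v)) (fun σ => σ ∘ ⇑(Equiv.addRight v)) = H)
    {Pp Pm : Matrix (Fin (n + 1)) (Fin (n + 1)) ℂ} (hPp : Pp.PosSemidef) (hPm : Pm.PosSemidef)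
    (hsum : Pp + Pm = 1) (hPpr : Pp.map (starRingEnd ℂ) = Pp) (hPmr : Pm.map (starRingEnd ℂ) = Pm)
    {κ : ℝ} (hκ0 : 0 < κ) (hκ1 : κ ≤ 1)
    (hsmall : ∀ (v i j : TorusSite 2 (N * b)),
      (∃ k : Fin 2, j = i + Pi.single k 1 ∨ i = j + Pi.single k 1) →
      blockOf N b (i - v) = blockOf N b (j - v) →
      (Matrix.gibbsState β H (productOp fun y =>
        cubePattern hN v (selectedOp Pp Pm {i} {j}) (blockOf N b (i - v))
          (mirroredOffset hN y))).re ≤ κ ^ (N ^ 2))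
    (hθ : κ ^ (((b - 1 : ℕ) : ℝ) / (b : ℝ) ^ (2 * 2 + 1)) ≤ 1 / 10 ^ 10)
    {m n' : TorusSite 2 (N * b)} (hmn : m ≠ n') :
    (1 : ℝ) / 2 ≤ (Matrix.gibbsState β H (onSite m (Pp - Pm) * onSite n' (Pp - Pm))).re := by
  obtain ⟨hρ, hhalf⟩ := pctl_threshold (Real.rpow_nonneg hκ0.le _) hθ
  exact hhalf.trans (peierls_chessboard_sigma_twoPoint_ge hN hN1 hL hH hK hT hPp hPm hsum hPpr hPmr
    hκ0 hκ1 hsmall hρ hmn)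

end Threshold

/-! ### The antiferromagnet with direction-dependent couplings (rotated frame) -/

section Model

variable {N b : ℕ} [NeZero N] [NeZero b] (n : ℕ)

/-- **Long-range-order floor for the rotated antiferromagnet `H♭_K`** (direction-dependent
couplings `K ≥ 0`, every spin, every `β ≥ 0`, `N` even, `N > 1`, `Nb ≥ 3`): for real `0 ≤ P±`
with `P⁺ + P⁻ = 1`, `σ = P⁺ - P⁻`, a dipole smallness bound `κ` and `ρ = 4·19⁶·κ^{(b-1)/b⁵} < 1`:
`Re⟨σₘσₙ⟩_{β,H♭_K} ≥ 1 - 16ρ/(1-ρ)²` for all `m ≠ n`, uniformly in `N`.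
[cite: FrohlichLieb1978, eqs. (1.11)–(1.24), Thm. 1.1, Cor. 1.2, §I.A (3)] -/
theorem heisAnisoReal_sigma_twoPoint_ge [NeZero (N * b)] (hN : Even N) (hN1 : 1 < N)
    (hL : 2 < N * b) {K : Fin 2 → ℝ} (hK : ∀ i, 0 ≤ K i) {β : ℝ} (hβ : 0 ≤ β)
    {Pp Pm : Matrix (Fin (n + 1)) (Fin (n + 1)) ℂ} (hPp : Pp.PosSemidef) (hPm : Pm.PosSemidef)
    (hsum : Pp + Pm = 1) (hPpr : Pp.map (starRingEnd ℂ) = Pp) (hPmr : Pm.map (starRingEnd ℂ) = Pm)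
    {κ : ℝ} (hκ0 : 0 < κ) (hκ1 : κ ≤ 1)
    (hsmall : ∀ (v i j : TorusSite 2 (N * b)),
      (∃ k : Fin 2, j = i + Pi.single k 1 ∨ i = j + Pi.single k 1) →
      blockOf N b (i - v) = blockOf N b (j - v) →
      (Matrix.gibbsState β (heisWeightedRealFieldHamiltonian (N * b) n (dirCoupling (N * b) K) 0)
        (productOp fun y => cubePattern hN v (selectedOp Pp Pm {i} {j}) (blockOf N b (i - v))
          (mirroredOffset hN y))).re ≤ κ ^ (N ^ 2))
    (hρ : 4 * 19 ^ 6 * κ ^ (((b - 1 : ℕ) : ℝ) / (b : ℝ) ^ (2 * 2 + 1)) < 1)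
    {m n' : TorusSite 2 (N * b)} (hmn : m ≠ n') :
    1 - 4 * (4 * (4 * 19 ^ 6 * κ ^ (((b - 1 : ℕ) : ℝ) / (b : ℝ) ^ (2 * 2 + 1))) /
        (1 - 4 * 19 ^ 6 * κ ^ (((b - 1 : ℕ) : ℝ) / (b : ℝ) ^ (2 * 2 + 1))) ^ 2) ≤
      (Matrix.gibbsState β (heisWeightedRealFieldHamiltonian (N * b) n (dirCoupling (N * b) K) 0)
        (onSite m (Pp - Pm) * onSite n' (Pp - Pm))).re :=
  peierls_chessboard_sigma_twoPoint_ge hN hN1 hL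
    (heisWeightedRealFieldHamiltonian_isHermitian (N * b) n _ 0)
    (fun i k => heisWeightedReal_isRPExponent (N * b) n (hN.mul_right b) (dirCoupling_nonneg _ hK)
      (fun j a e => dirCoupling_map_reflectBetweenSites (N * b) j a K e) hβ i (blockPlane N b k))
    (heisWeightedRealFieldHamiltonian_submatrix_comp_addRight (N * b) n
      (fun u e => dirCoupling_map_addRight (N * b) K u e))
    hPp hPm hsum hPpr hPmr hκ0 hκ1 hsmall hρ hmn

end Model

end Literature.MathematicalPhysics.QuantumLattice

end
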